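import Summits.Ventures.CertifiedManyBodySolver.Observables.StiffnessTLKineticTTOrbitDictionary
import Summits.Ventures.CertifiedManyBodySolver.Observables.StiffnessTPrimeSegmentLeaf
import Literature.MathematicalPhysics.QuantumLattice.HubbardTTPrimeApexRow
import HarnessLib

/-!
# Ventures/CertifiedManyBodySolver — Observables/StiffnessApexTransport.lean

HONEST FRAMING: one-sided certified CEILINGS on the uniform flux stiffness (t–t′ f-sum class), TRANSPORTED across the `(t′, U)`
plane; a ceiling never speaks to the presence of order; not a `T_c` estimate, not a superconductivity verdict; every leaf below is
CONDITIONAL on the source row / row family it names. Zero compute, no definition, no claim node, no `sorry`.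

Cell `pub/hubbard-downfold` (D-0150 L-DF2 «box ↦ one word»), seat `hubbard-downfold-unc-2` (`prover-hubbard-downfold-unc-2-g13-0`); written
for the `U`-INTERIOR of the hubbard-obs M2(b) box «La214-E» `[−3/10, −1/5] × [29/5, 74/5] × n = 1` (obs RULING (bbb) d298 (bbb3): «corners +
t′-edges certified, U-interior uncovered»; the `t′ ≠ 0` `U`-ray by the kinematic diagonal allowance is content-free, director R3′).

THE APEX RULE (`Literature/…/HubbardTTPrimeApexRow`): for torus-limit ground states `ω_A` at `A = (t′_A, U_A)`, `ω_P` at `P = (t′_P, U_P)`,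
`0 ≤ U_A < U_P`, same density, `U_P·(var. ineq. at A) + U_A·(var. ineq. at P)` eliminates the double occupancy: `e_{Φ(1,κ,0)}(ω_A) ≤ e_{Φ(1,κ,0)}(ω_P)`,
`κ` = the `t′`-intercept of the line `AP` at `U = 0`. The `D₄`-mean `t–t′` f-sum functional IS `−¼e_{Φ(1,2t′,0)}` (p2's dictionary), so for `A` on
the segment from the APEX `(2t′_P, 0)` to `P` (`U_P·t′_A = (2U_P − U_A)·t′_P`) the f-sum ceiling of the class at `P` is bounded EXACTLY by
`−¼e_{Φ(1,2t′_P,0)}(ω_A)`: ceilings flow from larger-`|t′|` / lower-`U` sources into a box (`U_A = 0` = the kinematic leaf, `U_A → U_P` = the point).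
At half filling (`t′·K₂ ≤ 0`) the source's OWN f-sum word bounds the target's, either sign of `t′`.

* §1 dictionary at an arbitrary hopping slot; §2 ANY density: leaf at `P` from a one-body floor on the SOURCE class (`…_of_forall_apexSource_oneBody_ge`),
  from a source orbit row for the TARGET's operator (`…_of_apexSource_orbitLowerRow`), from the source's own row + a `K₂` sign (`…_of_diagHop_sign`);
* §3 HALF FILLING: source's own row ⇒ leaf at `P` (`…_halfFilling_of_apexSource_fsumRow`); ONE corner row ⇒ its whole apex curve
  `(t′_A U/(2U − U_A), U)`, `U > U_A` (the «La214-E» corner `(29/5, 1, −3/10)` word holds verbatim at `(8,1,−4/17)`, `(10,1,−15/71)`, `(58/5,1,−1/5)`);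
* §4 BOX instrument: a row FAMILY on the source segment `[p(2 − U_A/U_max), q]` at ONE station `U_A` (the shape a shared-dual segment certificate
  delivers, `StiffnessTPrimeSegmentLeaf`) words the WHOLE box `[p, q] × [U_A, U_max]` (`…_on_box_…`, two-corner `…_chord`);
* «La214-E» instances (one station `29/5` with segment `[−357/740, −1/5]`; three stations `29/5, 8, 11` with overhang only to `≈ −0.383`) are in
  the companion `Observables/StiffnessApexTransportLaBoxE.lean`. Box word = worst source word; the overhang beyond `−3/10` is the price.

NOT said: nothing flows toward smaller `U`; a LEAF transports nowhere — only ROWS do; `λ ≠ 0` words are not of this form; no `T > 0`; no number.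

References: T. Koma, H. Tasaki, J. Stat. Phys. 76 (1994) 745, §1 [KomaTasaki1994]; D. J. Scalapino, S. R. White, S.-C. Zhang, PRB 47 (1993)
7995, §II [ScalapinoWhiteZhang1993]; T. Hazra, N. Verma, M. Randeria, PRX 9 (2019) 031049, eq. (4) [HazraVermaRanderia2019].
-/

noncomputable section

namespace Summit.Ventures.CertifiedManyBodySolver.Observables

open Literature.MathematicalPhysics.QuantumLattice
open Literature.MathematicalPhysics.QuantumLattice.ThermodynamicLimit
open Literature.MathematicalPhysics.QuantumFieldTheory
open Literature.Probability.LatticeModels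
open Matrix Finset Filter Topology HubbardWave0
open scoped Matrix BigOperators ComplexOrder

/-! ## §1 The orbit mean of the negated `λ = 0` word at an arbitrary hopping slot -/

/-- **Orbit mean of `Re ω_γ(−X₀(s))` in energy coordinates**, for a translation-invariant `ω` and ANY hopping slot `s` and `U`-slot `Uo`
of the operator (at `λ = 0` the `U`-slot is idle): `|D₄|⁻¹ Σ_γ Re ω_{γΛ₇}(Γ_γ(−X₀(s, Uo))) = ¼·e_{Φ(1,2s,0)}(ω)` — the class `ω` belongs to
plays no role (`orbitMean_rotOddMomentLimitFunctionalTT_lam_zero_eq_meanEnergy_twice_tPrime`). [cite: HazraVermaRanderia2019, eq. (4)] -/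
theorem orbitMean_re_expect_neg_oddMomentTT_lam_zero {ω : InfVolFermionState 2} (hω : ω.IsTranslationInvariant) (s Uo : ℝ) :
    ((Finset.univ : Finset (DihedralGroup 4)).card : ℝ)⁻¹ * ∑ g ∈ (Finset.univ : Finset (DihedralGroup 4)),
        (ω.expect (d4ShiftSet g 0 (box 2 7)) (fermionEmbed (PolySite.d4Emb g 0 (box 2 7)) (-oddMomentObsTT s Uo 0))).re =
      (1 / 4) * ω.meanEnergy (hubbardTTPrimeFermionInteraction 1 (2 * s) 0) 1 := by
  have hneg : ∀ γ : DihedralGroup 4,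
      (ω.expect (d4ShiftSet γ 0 (box 2 7)) (fermionEmbed (PolySite.d4Emb γ 0 (box 2 7)) (-oddMomentObsTT s Uo 0))).re =
        -rotOddMomentLimitFunctionalTT s Uo 0 γ ω := by
    intro γ
    unfold rotOddMomentLimitFunctionalTT
    rw [map_neg, map_neg, Complex.neg_re]
  simp_rw [hneg, Finset.sum_neg_distrib, mul_neg]
  rw [orbitMean_rotOddMomentLimitFunctionalTT_lam_zero_eq_meanEnergy_twice_tPrime hω s Uo]
  ring

/-! ## §2 Any density: the leaf at the target from a functional bound on the SOURCE class -/

section AnyDensity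

variable {t'P UP t'A UA n : ℝ}

/-- **Apex transport of the f-sum leaf, functional form (any density).** `0 ≤ U_A < U_P`, `U_P·t′_A = (2U_P − U_A)·t′_P` (the source
`A = (t′_A, U_A)` lies on the segment from the apex `(2t′_P, 0)` to the target `P = (t′_P, U_P)`), `0 ≤ n < 2`. If `ℓ ≤ e_{Φ(1,2t′_P,0)}(ω_A)` for every
torus limit `ω_A` of unit `(rectN n L, S^z = 0)`-sector ground states of `hubbardTorusTT' L 1 t′_A U_A` (a floor on the one-body energy at
DOUBLED TARGET hopping, on the SOURCE class), then `ObsStiffnessSeqCeilingAt t′_P U_P n c` for every rational `c ≥ −ℓ/4`. Proof: the orbit tower at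
`λ = 0`, `S = D₄`; on the target class the orbit functional is `−¼e_{Φ(1,2t′_P,0)}(ω_P) ≤ −¼e_{Φ(1,2t′_P,0)}(ω_A)` by the doubled-hopping apex row
against an inhabitant `ω_A` of the source class. [cite: KomaTasaki1994, §1] [cite: ScalapinoWhiteZhang1993, §II] -/
theorem ObsStiffnessSeqCeilingAt_of_forall_apexSource_oneBody_ge (hUA : 0 ≤ UA) (hU : UA < UP)
    (hapex : UP * t'A = (2 * UP - UA) * t'P) (hn0 : 0 ≤ n) (hn2 : n < 2) {ℓ : ℝ}
    (h : ∀ (ω : InfVolFermionState 2) (Ls : ℕ → ℕ) (ψ : ∀ L, Fock (Orb (FermionTorus 2 L))),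
      Tendsto Ls atTop atTop →
      (∀ j, IsGroundStateInSector (hubbardTorusTT' (Ls j) 1 t'A UA) (rectN n (Ls j)) 0 (ψ (Ls j))) →
      (∀ j, star (ψ (Ls j)) ⬝ᵥ ψ (Ls j) = 1) → ω.IsTorusLimitOf ψ Ls →
      ℓ ≤ ω.meanEnergy (hubbardTTPrimeFermionInteraction 1 (2 * t'P) 0) 1)
    (c : ℚ) (hc : -ℓ / 4 ≤ ((c : ℚ) : ℝ)) :
    ObsStiffnessSeqCeilingAt t'P UP n c := by
  intro ρs θ₀ _ hθ₀ Ls hLs hst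
  refine (fluxStiffness_le_of_torusLimitTT'_oddMoment_orbit_certificate_seq t'P (U := UP) (δ := 1 - n) (q := -ℓ / 4) 0
    Finset.univ Finset.univ_nonempty (by linarith) (by linarith) hθ₀ hLs hst ?_).trans hc
  intro ω Ms ψ hMs hψ h1 hω
  have hψ' : ∀ j, IsGroundStateInSector (hubbardTorusTT' (Ms j) 1 t'P UP) (rectN n (Ms j)) 0 (ψ (Ms j)) := fun j => by
    simpa only [sub_sub_cancel] using hψ j
  rw [orbitMean_rotOddMomentLimitFunctionalTT_lam_zero_eq_meanEnergy_twice_tPrime hω.isTranslationInvariant]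
  obtain ⟨ψA, φ, ωA, hφ, hψA, hψA1, hωA, -, -, -⟩ :=
    exists_isTorusLimitOf_sectorGroundState_TT' 1 t'A UA hn0 hn2.le (Ls := id) tendsto_id
  have hLφ : Tendsto (id ∘ φ : ℕ → ℕ) atTop atTop := tendsto_id.comp hφ.tendsto_atTop
  have hapx := InfVolFermionState.IsTorusLimitOf.meanEnergy_twice_tPrime_le_of_groundStates_apex 1 t'A t'P hUA hU hapex
    hn0 hn2 hωA hLφ (fun j => hψA _) (fun j => hψA1 _) hω hMs hψ' h1
  have hℓ := h ωA (id ∘ φ) ψA hLφ (fun j => hψA _) (fun j => hψA1 _) hωA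
  linarith

/-- **Apex transport from a certified orbit LOWER row at the source for the TARGET's f-sum operator.** Same geometry; if the source
certificate at `(t′_A, U_A, n)` carries the objective row `r ≤ |D₄|⁻¹ Σ_γ Re ω_γ(−X₀(t′_P))` (the `λ = 0` word at the TARGET hopping `t′_P`;
any `U`-slot `Uo`) under its cap `e₀(1,t′_A,U_A,n) ≤ u`, and the cap is certified, then `ObsStiffnessSeqCeilingAt t′_P U_P n c` for every
`c ≥ −r`. [cite: KomaTasaki1994, §1] [cite: ScalapinoWhiteZhang1993, §II] -/
theorem ObsStiffnessSeqCeilingAt_of_apexSource_orbitLowerRow (Uo : ℝ) (hUA : 0 ≤ UA) (hU : UA < UP)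
    (hapex : UP * t'A = (2 * UP - UA) * t'P) (hn0 : 0 ≤ n) (hn2 : n < 2) {u r : ℚ}
    (hrow : SquareTTPrimeCorrOrbitLowerRow t'A UA n u r Finset.univ (box 2 7) (-oddMomentObsTT t'P Uo 0))
    (hu : energyDensityTT' 1 t'A UA n ≤ ((u : ℚ) : ℝ)) (c : ℚ) (hc : -r ≤ c) :
    ObsStiffnessSeqCeilingAt t'P UP n c := by
  have hc' : -((r : ℚ) : ℝ) ≤ ((c : ℚ) : ℝ) := by exact_mod_cast hc
  refine ObsStiffnessSeqCeilingAt_of_forall_apexSource_oneBody_ge hUA hU hapex hn0 hn2 (ℓ := 4 * ((r : ℚ) : ℝ))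
    (fun ω Ls ψ hLs hψ h1 hω => ?_) c (by linarith)
  have h := hrow ω Ls ψ hLs hψ h1 hω hu
  rw [orbitMean_re_expect_neg_oddMomentTT_lam_zero hω.isTranslationInvariant] at h
  linarith

/-- **Apex transport from the source's OWN f-sum row plus a certified sign of the diagonal-hopping energy** (any density): if the
source class at `(t′_A, U_A, n)` carries its own f-sum orbit row `r ≤ |D₄|⁻¹ Σ_γ Re ω_γ(−X₀(t′_A))` under the cap `e₀ ≤ u` (certified), and
`0 ≤ (t′_P − t′_A)·K₂(ω_A)` on the source class (a certified SIGN of `K₂ = e_{Φ(0,1,0)}`, e.g. a `t′`-chord floor of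
`Observables/DiagHopChordRows.lean`; automatic at half filling, §3), then `ObsStiffnessSeqCeilingAt t′_P U_P n c` for every `c ≥ −r`
(`e_{Φ(1,2t′_A,0)} ≤ e_{Φ(1,2t′_P,0)}` on the source class by the affine identity). [cite: KomaTasaki1994, §1] [cite: ScalapinoWhiteZhang1993, §II] -/
theorem ObsStiffnessSeqCeilingAt_of_apexSource_fsumRow_of_diagHop_sign (Uo : ℝ) (hUA : 0 ≤ UA) (hU : UA < UP)
    (hapex : UP * t'A = (2 * UP - UA) * t'P) (hn0 : 0 ≤ n) (hn2 : n < 2) {u r : ℚ}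
    (hrow : SquareTTPrimeCorrOrbitLowerRow t'A UA n u r Finset.univ (box 2 7) (-oddMomentObsTT t'A Uo 0))
    (hu : energyDensityTT' 1 t'A UA n ≤ ((u : ℚ) : ℝ))
    (hK₂ : ∀ (ω : InfVolFermionState 2) (Ls : ℕ → ℕ) (ψ : ∀ L, Fock (Orb (FermionTorus 2 L))),
      Tendsto Ls atTop atTop →
      (∀ j, IsGroundStateInSector (hubbardTorusTT' (Ls j) 1 t'A UA) (rectN n (Ls j)) 0 (ψ (Ls j))) →
      (∀ j, star (ψ (Ls j)) ⬝ᵥ ψ (Ls j) = 1) → ω.IsTorusLimitOf ψ Ls →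
      0 ≤ (t'P - t'A) * ω.meanEnergy (hubbardTTPrimeFermionInteraction 0 1 0) 1)
    (c : ℚ) (hc : -r ≤ c) :
    ObsStiffnessSeqCeilingAt t'P UP n c := by
  have hc' : -((r : ℚ) : ℝ) ≤ ((c : ℚ) : ℝ) := by exact_mod_cast hc
  refine ObsStiffnessSeqCeilingAt_of_forall_apexSource_oneBody_ge hUA hU hapex hn0 hn2 (ℓ := 4 * ((r : ℚ) : ℝ))
    (fun ω Ls ψ hLs hψ h1 hω => ?_) c (by linarith)
  have h := hrow ω Ls ψ hLs hψ h1 hω hu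
  rw [orbitMean_re_expect_neg_oddMomentTT_lam_zero hω.isTranslationInvariant] at h
  have hs := hK₂ ω Ls ψ hLs hψ h1 hω
  have haff := ω.meanEnergy_hubbardTTPrime_affine 1 (2 * t'A) 0 (2 * t'P) 0
  rw [sub_self, zero_mul, add_zero] at haff
  rw [haff]
  nlinarith [hs]

end AnyDensity

/-! ## §3 Half filling: the source's own f-sum row suffices (either sign of `t′`) -/

section HalfFilling

variable {t'P UP t'A UA : ℝ}

/-- **HALF FILLING: the f-sum word flows along the apex segment.** `0 ≤ U_A < U_P`, `U_P·t′_A = (2U_P − U_A)·t′_P`, density `1`, any sign of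
`t′`. If the SOURCE class at `(t′_A, U_A, 1)` carries its own certified f-sum orbit row `r ≤ |D₄|⁻¹ Σ_γ Re ω_γ(−X₀(t′_A))` (any `U`-slot `Uo`)
under the cap `e₀(1,t′_A,U_A,1) ≤ u`, and the cap is certified, then `ObsStiffnessSeqCeilingAt t′_P U_P 1 c` for every `c ≥ −r`: the word
certified at `A` IS a word at `P` (`IsTorusLimitOf.meanEnergy_twice_tPrime_source_le_of_groundStates_apex_halfFilling`: at `n = 1` the
diagonal-hopping energy has the sign of `−t′`). [cite: KomaTasaki1994, §1] [cite: ScalapinoWhiteZhang1993, §II] -/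
theorem ObsStiffnessSeqCeilingAt_halfFilling_of_apexSource_fsumRow (Uo : ℝ) (hUA : 0 ≤ UA) (hU : UA < UP)
    (hapex : UP * t'A = (2 * UP - UA) * t'P) {u r : ℚ}
    (hrow : SquareTTPrimeCorrOrbitLowerRow t'A UA 1 u r Finset.univ (box 2 7) (-oddMomentObsTT t'A Uo 0))
    (hu : energyDensityTT' 1 t'A UA 1 ≤ ((u : ℚ) : ℝ)) (c : ℚ) (hc : -r ≤ c) :
    ObsStiffnessSeqCeilingAt t'P UP 1 c := by
  intro ρs θ₀ _ hθ₀ Ls hLs hst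
  refine (fluxStiffness_le_of_torusLimitTT'_oddMoment_orbit_certificate_seq t'P (U := UP) (δ := 1 - 1) (q := -((r : ℚ) : ℝ)) 0
    Finset.univ Finset.univ_nonempty (by norm_num) (by norm_num) hθ₀ hLs hst ?_).trans (by exact_mod_cast hc)
  intro ω Ms ψ hMs hψ h1 hω
  have hψ' : ∀ j, IsGroundStateInSector (hubbardTorusTT' (Ms j) 1 t'P UP) (rectN 1 (Ms j)) 0 (ψ (Ms j)) := fun j => by
    simpa only [sub_sub_cancel] using hψ j
  rw [orbitMean_rotOddMomentLimitFunctionalTT_lam_zero_eq_meanEnergy_twice_tPrime hω.isTranslationInvariant]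
  obtain ⟨ψA, φ, ωA, hφ, hψA, hψA1, hωA, -, -, -⟩ :=
    exists_isTorusLimitOf_sectorGroundState_TT' 1 t'A UA zero_le_one one_le_two (Ls := id) tendsto_id
  have hLφ : Tendsto (id ∘ φ : ℕ → ℕ) atTop atTop := tendsto_id.comp hφ.tendsto_atTop
  have hapx := InfVolFermionState.IsTorusLimitOf.meanEnergy_twice_tPrime_source_le_of_groundStates_apex_halfFilling 1 t'A t'P
    hUA hU hapex hωA hLφ (fun j => hψA _) (fun j => hψA1 _) hω hMs hψ' h1
  have hv := hrow ωA (id ∘ φ) ψA hLφ (fun j => hψA _) (fun j => hψA1 _) hωA hu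
  rw [orbitMean_re_expect_neg_oddMomentTT_lam_zero hωA.isTranslationInvariant] at hv
  linarith

/-- **ONE corner row covers its whole apex curve (half filling).** A certified f-sum orbit row `r` at `(t′_A, U_A, 1)` (`U_A ≥ 0`, cap `u`
certified) gives `ObsStiffnessSeqCeilingAt (t′_A·U/(2U − U_A)) U 1 c` for EVERY `U > U_A` and every `c ≥ −r`: along the curve
`t′(U) = t′_A U/(2U − U_A)` (from `t′_A` at `U_A` to `t′_A/2` as `U → ∞`) the corner word holds verbatim. Example («La214-E» corner
`(29/5, 1, −3/10)`): at `U = 8, 10, 58/5` the curve passes `t′ = −4/17, −15/71, −1/5`. [cite: KomaTasaki1994, §1] [cite: ScalapinoWhiteZhang1993, §II] -/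
theorem ObsStiffnessSeqCeilingAt_halfFilling_on_apexCurve_of_fsumRow (Uo : ℝ) (hUA : 0 ≤ UA) {u r : ℚ}
    (hrow : SquareTTPrimeCorrOrbitLowerRow t'A UA 1 u r Finset.univ (box 2 7) (-oddMomentObsTT t'A Uo 0))
    (hu : energyDensityTT' 1 t'A UA 1 ≤ ((u : ℚ) : ℝ)) (c : ℚ) (hc : -r ≤ c) {U : ℝ} (hU : UA < U) :
    ObsStiffnessSeqCeilingAt (t'A * U / (2 * U - UA)) U 1 c := by
  have h2 : 2 * U - UA ≠ 0 := ne_of_gt (by linarith)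
  refine ObsStiffnessSeqCeilingAt_halfFilling_of_apexSource_fsumRow Uo hUA hU ?_ hrow hu c hc
  have e : (2 * U - UA) * (t'A * U / (2 * U - UA)) = t'A * U := by field_simp
  rw [e, mul_comm]

/-- The three «La214-E» curve points quoted above: `(−3/10)·8/(16 − 29/5) = −4/17`, `(−3/10)·10/(20 − 29/5) = −15/71`,
`(−3/10)·(58/5)/(116/5 − 29/5) = −1/5`. [folklore] -/
theorem laBoxE_corner29o5_apexCurve_points :
    (-3 / 10 : ℝ) * 8 / (2 * 8 - 29 / 5) = -4 / 17 ∧ (-3 / 10 : ℝ) * 10 / (2 * 10 - 29 / 5) = -15 / 71 ∧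
      (-3 / 10 : ℝ) * (58 / 5) / (2 * (58 / 5) - 29 / 5) = -1 / 5 := by
  refine ⟨?_, ?_, ?_⟩ <;> norm_num

end HalfFilling

/-! ## §4 The BOX instrument: one source `t′`-segment at a station `U_A` covers the slab above it -/

/-- **Where the source of a box point sits.** Station `U_A > 0`, slab `U_A ≤ U_P ≤ U_max`, targets `t′_P ∈ [p, q]` with `q ≤ 0`: the source
parameter `t′_P(2U_P − U_A)/U_P` (the point of the station on the segment from the apex `(2t′_P,0)` to `(t′_P,U_P)`) lies in
`[p·(2 − U_A/U_max), q]` — the factor `2 − U_A/U_P ∈ [1, 2 − U_A/U_max]` multiplies a non-positive `t′_P`. [folklore] -/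
theorem apexSource_mem_Icc_of_slab {UA Umax p q t'P UP : ℝ} (hUA : 0 < UA) (hU : UA ≤ UP) (hUmax : UP ≤ Umax)
    (hq : q ≤ 0) (ht : t'P ∈ Set.Icc p q) :
    t'P * (2 * UP - UA) / UP ∈ Set.Icc (p * (2 - UA / Umax)) q := by
  have hUP : 0 < UP := hUA.trans_le hU
  have htP : t'P ≤ 0 := ht.2.trans hq
  have e : t'P * (2 * UP - UA) / UP = t'P * (2 - UA / UP) := by
    field_simp
  rw [e]
  have hf1 : 1 ≤ 2 - UA / UP := by
    have : UA / UP ≤ 1 := (div_le_one hUP).2 hU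
    linarith
  have hf2 : 2 - UA / UP ≤ 2 - UA / Umax := by
    have : UA / Umax ≤ UA / UP := div_le_div_of_nonneg_left hUA.le hUP hUmax
    linarith
  have hf0 : 0 ≤ 2 - UA / Umax := by linarith
  constructor
  · calc p * (2 - UA / Umax) ≤ t'P * (2 - UA / Umax) := mul_le_mul_of_nonneg_right ht.1 hf0
      _ ≤ t'P * (2 - UA / UP) := mul_le_mul_of_nonpos_left hf2 htP
  · calc t'P * (2 - UA / UP) ≤ t'P * 1 := mul_le_mul_of_nonpos_left hf1 htP
      _ ≤ q := by rw [mul_one]; exact ht.2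

section Station

variable {UA a b : ℝ}

/-- **The half-filling f-sum leaf at a point from an orbit-lower FAMILY on a source segment at ONE station.** Station `U_A ≥ 0`; for every
`s ∈ [a, b]` and every torus limit `ω` of unit `(rectN 1 L, S^z = 0)`-sector ground states of `hubbardTorusTT' L 1 s U_A`, the UNCONDITIONAL
orbit-lower statement `val s ≤ |D₄|⁻¹ Σ_γ Re ω_{γΛ₇}(Γ_γ(−X₀(s)))` (energy cap already discharged — the shape two corner certificates with a
shared dual deliver on the segment, `…ConvexCombObjective` / `StiffnessTPrimeSegmentLeaf`), with `−val s ≤ c` on `[a, b]`. Then for every target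
`(t′_P, U_P)` with `U_A ≤ U_P`, `U_P > 0`, whose source parameter `t′_P(2U_P − U_A)/U_P` lies in `[a, b]`: `ObsStiffnessSeqCeilingAt t′_P U_P 1 c`.
[cite: KomaTasaki1994, §1] [cite: ScalapinoWhiteZhang1993, §II] -/
theorem ObsStiffnessSeqCeilingAt_halfFilling_of_forall_apexStation_orbitLower (hUA : 0 ≤ UA) (val : ℝ → ℝ) (c : ℚ)
    (h : ∀ s ∈ Set.Icc a b, ∀ (ω : InfVolFermionState 2) (Ls : ℕ → ℕ) (ψ : ∀ L, Fock (Orb (FermionTorus 2 L))),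
      Tendsto Ls atTop atTop →
      (∀ j, IsGroundStateInSector (hubbardTorusTT' (Ls j) 1 s UA) (rectN 1 (Ls j)) 0 (ψ (Ls j))) →
      (∀ j, star (ψ (Ls j)) ⬝ᵥ ψ (Ls j) = 1) → ω.IsTorusLimitOf ψ Ls →
      val s ≤ ((Finset.univ : Finset (DihedralGroup 4)).card : ℝ)⁻¹ * ∑ g ∈ (Finset.univ : Finset (DihedralGroup 4)),
        (ω.expect (d4ShiftSet g 0 (box 2 7)) (fermionEmbed (PolySite.d4Emb g 0 (box 2 7)) (-oddMomentObsTT s UA 0))).re)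
    (hc : ∀ s ∈ Set.Icc a b, -val s ≤ ((c : ℚ) : ℝ))
    {t'P UP : ℝ} (hU : UA ≤ UP) (hUP : 0 < UP) (hs : t'P * (2 * UP - UA) / UP ∈ Set.Icc a b) :
    ObsStiffnessSeqCeilingAt t'P UP 1 c := by
  intro ρs θ₀ _ hθ₀ Ls hLs hst
  refine fluxStiffness_le_of_torusLimitTT'_oddMoment_orbit_certificate_seq t'P (U := UP) (δ := 1 - 1) (q := ((c : ℚ) : ℝ)) 0
    Finset.univ Finset.univ_nonempty (by norm_num) (by norm_num) hθ₀ hLs hst ?_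
  intro ω Ms ψ hMs hψ h1 hω
  have hψ' : ∀ j, IsGroundStateInSector (hubbardTorusTT' (Ms j) 1 t'P UP) (rectN 1 (Ms j)) 0 (ψ (Ms j)) := fun j => by
    simpa only [sub_sub_cancel] using hψ j
  rw [orbitMean_rotOddMomentLimitFunctionalTT_lam_zero_eq_meanEnergy_twice_tPrime hω.isTranslationInvariant]
  rcases hU.eq_or_lt with heq | hlt
  · -- the station IS the target coupling: the source parameter is `t′_P` itself
    subst heq
    have hs1 : t'P * (2 * UA - UA) / UA = t'P := by field_simp; ring
    rw [hs1] at hs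
    have hv := h t'P hs ω Ms ψ hMs hψ' h1 hω
    rw [orbitMean_re_expect_neg_oddMomentTT_lam_zero hω.isTranslationInvariant] at hv
    have hc' := hc t'P hs
    linarith
  · -- genuine transport from an inhabitant of the source class at the station
    have hapex : UP * (t'P * (2 * UP - UA) / UP) = (2 * UP - UA) * t'P := by
      field_simp
    obtain ⟨ψA, φ, ωA, hφ, hψA, hψA1, hωA, -, -, -⟩ :=
      exists_isTorusLimitOf_sectorGroundState_TT' 1 (t'P * (2 * UP - UA) / UP) UA zero_le_one one_le_two (Ls := id)
        tendsto_id
    have hLφ : Tendsto (id ∘ φ : ℕ → ℕ) atTop atTop := tendsto_id.comp hφ.tendsto_atTop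
    have hapx := InfVolFermionState.IsTorusLimitOf.meanEnergy_twice_tPrime_source_le_of_groundStates_apex_halfFilling 1
      (t'P * (2 * UP - UA) / UP) t'P hUA hlt hapex hωA hLφ (fun j => hψA _) (fun j => hψA1 _) hω hMs hψ' h1
    have hv := h _ hs ωA (id ∘ φ) ψA hLφ (fun j => hψA _) (fun j => hψA1 _) hωA
    rw [orbitMean_re_expect_neg_oddMomentTT_lam_zero hωA.isTranslationInvariant] at hv
    have hc' := hc _ hs
    linarith

end Station

section Box

variable {UA Umax p q : ℝ}

/-- **THE BOX FROM ONE STATION (half filling).** `0 < U_A`, targets `t′ ∈ [p, q]` with `q ≤ 0`, `U ∈ [U_A, U_max]`. An unconditional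
orbit-lower family `val` for the `t–t′` f-sum word on the source segment `s ∈ [p·(2 − U_A/U_max), q]` at the station `U_A` (torus-limit ground
states of `hubbardTorusTT' L 1 s U_A` at density `1`), with `−val s ≤ c` there, gives `ObsStiffnessSeqCeilingAt t′ U 1 c` at EVERY point of the
box `[p, q] × [U_A, U_max]`: the `U`-interior is covered from the low-`U` edge extended in `t′` by the factor `2 − U_A/U_max`. [cite: KomaTasaki1994, §1] [cite: ScalapinoWhiteZhang1993, §II] -/
theorem ObsStiffnessSeqCeilingAt_halfFilling_on_box_of_forall_apexStation_orbitLower (hUA : 0 < UA) (hq : q ≤ 0)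
    (val : ℝ → ℝ) (c : ℚ)
    (h : ∀ s ∈ Set.Icc (p * (2 - UA / Umax)) q,
      ∀ (ω : InfVolFermionState 2) (Ls : ℕ → ℕ) (ψ : ∀ L, Fock (Orb (FermionTorus 2 L))),
      Tendsto Ls atTop atTop →
      (∀ j, IsGroundStateInSector (hubbardTorusTT' (Ls j) 1 s UA) (rectN 1 (Ls j)) 0 (ψ (Ls j))) →
      (∀ j, star (ψ (Ls j)) ⬝ᵥ ψ (Ls j) = 1) → ω.IsTorusLimitOf ψ Ls →
      val s ≤ ((Finset.univ : Finset (DihedralGroup 4)).card : ℝ)⁻¹ * ∑ g ∈ (Finset.univ : Finset (DihedralGroup 4)),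
        (ω.expect (d4ShiftSet g 0 (box 2 7)) (fermionEmbed (PolySite.d4Emb g 0 (box 2 7)) (-oddMomentObsTT s UA 0))).re)
    (hc : ∀ s ∈ Set.Icc (p * (2 - UA / Umax)) q, -val s ≤ ((c : ℚ) : ℝ)) :
    ∀ tp ∈ Set.Icc p q, ∀ U ∈ Set.Icc UA Umax, ObsStiffnessSeqCeilingAt tp U 1 c := by
  intro tp htp U hU
  exact ObsStiffnessSeqCeilingAt_halfFilling_of_forall_apexStation_orbitLower hUA.le val c h hc hU.1 (hUA.trans_le hU.1)
    (apexSource_mem_Icc_of_slab hUA hU.1 hU.2 hq htp)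

/-- **Two-corner form of the box theorem.** If the family on the source segment `[s₁, s₂]`, `s₁ = p(2 − U_A/U_max) < s₂ = q ≤ 0`, is the
CHORD `λ₁(s)v₁ + λ₂(s)v₂` of two corner constants (`λᵢ` the barycentric weights of `s` — what two corner certificates at `(s₁, U_A)`, `(s₂, U_A)`
sharing one dual give, `…_convexCombObj_TT'_ineq_affine` with `oddMomentObsTT_lamZero_affine`), then `ObsStiffnessSeqCeilingAt tp U 1 c` on the
whole box `[p, q] × [U_A, U_max]` for every `c ≥ max(−v₁, −v₂)`: TWO corner certificates at ONE station word the whole `(t′, U)` box.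
[cite: KomaTasaki1994, §1] [cite: ScalapinoWhiteZhang1993, §II] -/
theorem ObsStiffnessSeqCeilingAt_halfFilling_on_box_of_apexStation_chord (hUA : 0 < UA) (hq : q ≤ 0)
    (h12 : p * (2 - UA / Umax) < q) (v₁ v₂ : ℝ) (c : ℚ) (hc₁ : -v₁ ≤ ((c : ℚ) : ℝ)) (hc₂ : -v₂ ≤ ((c : ℚ) : ℝ))
    (h : ∀ s ∈ Set.Icc (p * (2 - UA / Umax)) q,
      ∀ (ω : InfVolFermionState 2) (Ls : ℕ → ℕ) (ψ : ∀ L, Fock (Orb (FermionTorus 2 L))),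
      Tendsto Ls atTop atTop →
      (∀ j, IsGroundStateInSector (hubbardTorusTT' (Ls j) 1 s UA) (rectN 1 (Ls j)) 0 (ψ (Ls j))) →
      (∀ j, star (ψ (Ls j)) ⬝ᵥ ψ (Ls j) = 1) → ω.IsTorusLimitOf ψ Ls →
      (q - s) / (q - p * (2 - UA / Umax)) * v₁ + (s - p * (2 - UA / Umax)) / (q - p * (2 - UA / Umax)) * v₂ ≤
        ((Finset.univ : Finset (DihedralGroup 4)).card : ℝ)⁻¹ * ∑ g ∈ (Finset.univ : Finset (DihedralGroup 4)),
          (ω.expect (d4ShiftSet g 0 (box 2 7)) (fermionEmbed (PolySite.d4Emb g 0 (box 2 7)) (-oddMomentObsTT s UA 0))).re) :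
    ∀ tp ∈ Set.Icc p q, ∀ U ∈ Set.Icc UA Umax, ObsStiffnessSeqCeilingAt tp U 1 c := by
  refine ObsStiffnessSeqCeilingAt_halfFilling_on_box_of_forall_apexStation_orbitLower hUA hq
    (fun s => (q - s) / (q - p * (2 - UA / Umax)) * v₁ + (s - p * (2 - UA / Umax)) / (q - p * (2 - UA / Umax)) * v₂) c h
    fun s hs => ?_
  obtain ⟨hl₁, hl₂, hsum, -, -⟩ := tPrimeSegment_weights h12 hs.1 hs.2
  have hmin := min_le_chord_of_weights (c₁ := v₁) (c₂ := v₂) hl₁ hl₂ hsum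
  have hneg : -min v₁ v₂ ≤ ((c : ℚ) : ℝ) := by
    rcases le_total v₁ v₂ with hv | hv
    · rw [min_eq_left hv]; exact hc₁
    · rw [min_eq_right hv]; exact hc₂
  linarith

end Box


/-! ## §5 What ONE point source words at half filling: the apex REGION, not only the apex curve (append, same seat) -/

section Region

variable {t'A UA : ℝ}

/-- **One corner row words a 2-D REGION (half filling).** A certified f-sum orbit row `r` at the source `(t′_A, U_A, 1)` (`U_A ≥ 0`, cap `u`
certified) gives `ObsStiffnessSeqCeilingAt t′_P U_P 1 c` (`c ≥ −r`) for EVERY target with `U_A < U_P`, `t′_P < 0` and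
`U_A·t′_P ≤ t′_A·(2U_A − U_P)`, `t′_A·U_P ≤ t′_P·(2U_P − U_A)` — i.e. the apex hopping `κ = (U_P t′_A − U_A t′_P)/(U_P − U_A)` of the line `AP`
satisfies `2t′_A ≤ κ ≤ 2t′_P`: then `−¼e_{Φ(1,2t′_P,0)}(ω_P) ≤ −¼e_{Φ(1,κ,0)}(ω_P) ≤ −¼e_{Φ(1,κ,0)}(ω_A) ≤ −¼e_{Φ(1,2t′_A,0)}(ω_A) ≤ −r` (sign of `K₂` at
both ends by `t′K₂ ≤ 0`, the apex row in between). The region is bounded by the apex CURVE `t′ = t′_A U/(2U − U_A)` (§3) and the LINE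
`t′ = t′_A(2U_A − U)/U_A` through `A` and `(0, 2U_A)`; it is thin near the source (width `∝ (U − U_A)²`) and fat away from it. Example: the
«La214-E» corner `(29/5, 1, −3/10)` words the column `t′ ∈ [−4/17, −27/145]` at `U = 8` and `t′ ∈ [−15/71, −12/145]` at `U = 10`.
[cite: KomaTasaki1994, §1] [cite: ScalapinoWhiteZhang1993, §II] -/
theorem ObsStiffnessSeqCeilingAt_halfFilling_on_apexRegion_of_fsumRow (Uo : ℝ) (hUA : 0 ≤ UA) {u r : ℚ}
    (hrow : SquareTTPrimeCorrOrbitLowerRow t'A UA 1 u r Finset.univ (box 2 7) (-oddMomentObsTT t'A Uo 0))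
    (hu : energyDensityTT' 1 t'A UA 1 ≤ ((u : ℚ) : ℝ)) (c : ℚ) (hc : -r ≤ c) {t'P UP : ℝ} (hU : UA < UP)
    (ht'P : t'P < 0) (h₁ : UA * t'P ≤ t'A * (2 * UA - UP)) (h₂ : t'A * UP ≤ t'P * (2 * UP - UA)) :
    ObsStiffnessSeqCeilingAt t'P UP 1 c := by
  have hd : 0 < UP - UA := sub_pos.2 hU
  have hUP : 0 < UP := hUA.trans_lt hU
  have ht'A : t'A < 0 := by
    by_contra hcon
    have : t'P * (2 * UP - UA) < 0 := mul_neg_of_neg_of_pos ht'P (by linarith)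
    nlinarith [mul_nonneg (not_lt.1 hcon) hUP.le]
  set κ : ℝ := (UP * t'A - UA * t'P) / (UP - UA) with hκ_def
  have hκmul : κ * (UP - UA) = UP * t'A - UA * t'P := by rw [hκ_def]; field_simp
  have hκP : κ ≤ 2 * t'P := by nlinarith [hκmul, h₂, hd]
  have hκA : 2 * t'A ≤ κ := by nlinarith [hκmul, h₁, hd]
  have hcP : 0 ≤ (κ - 2 * t'P) / t'P := div_nonneg_of_nonpos (by linarith) ht'P.le
  have heP : κ - 2 * t'P = (κ - 2 * t'P) / t'P * t'P := by rw [div_mul_cancel₀ _ ht'P.ne]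
  have hcA : 0 ≤ (2 * t'A - κ) / t'A := div_nonneg_of_nonpos (by linarith) ht'A.le
  have heA : 2 * t'A - κ = (2 * t'A - κ) / t'A * t'A := by rw [div_mul_cancel₀ _ ht'A.ne]
  have hc' : -((r : ℚ) : ℝ) ≤ ((c : ℚ) : ℝ) := by exact_mod_cast hc
  intro ρs θ₀ _ hθ₀ Ls hLs hst
  refine (fluxStiffness_le_of_torusLimitTT'_oddMoment_orbit_certificate_seq t'P (U := UP) (δ := 1 - 1) (q := -((r : ℚ) : ℝ)) 0
    Finset.univ Finset.univ_nonempty (by norm_num) (by norm_num) hθ₀ hLs hst ?_).trans hc'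
  intro ω Ms ψ hMs hψ h1 hω
  have hψ' : ∀ j, IsGroundStateInSector (hubbardTorusTT' (Ms j) 1 t'P UP) (rectN 1 (Ms j)) 0 (ψ (Ms j)) := fun j => by
    simpa only [sub_sub_cancel] using hψ j
  rw [orbitMean_rotOddMomentLimitFunctionalTT_lam_zero_eq_meanEnergy_twice_tPrime hω.isTranslationInvariant]
  obtain ⟨ψA, φ, ωA, hφ, hψA, hψA1, hωA, -, -, -⟩ :=
    exists_isTorusLimitOf_sectorGroundState_TT' 1 t'A UA zero_le_one one_le_two (Ls := id) tendsto_id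
  have hLφ : Tendsto (id ∘ φ : ℕ → ℕ) atTop atTop := tendsto_id.comp hφ.tendsto_atTop
  -- target end: `e_κ(ω_P) ≤ e_{2t′_P}(ω_P)`
  have hP := InfVolFermionState.IsTorusLimitOf.meanEnergy_oneBody_anti_hopping_of_groundState_halfFilling 1 t'P
    (hUA.trans hU.le) hω hMs hψ' h1 (κ := 2 * t'P) (κ' := κ) hcP heP
  -- apex row: `e_κ(ω_A) ≤ e_κ(ω_P)`
  have hapx := InfVolFermionState.IsTorusLimitOf.meanEnergy_apexHopping_le_of_groundStates 1 t'A t'P hUA hU zero_le_one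
    one_lt_two hωA hLφ (fun j => hψA _) (fun j => hψA1 _) hω hMs hψ' h1
  -- source end: `e_{2t′_A}(ω_A) ≤ e_κ(ω_A)`
  have hA := InfVolFermionState.IsTorusLimitOf.meanEnergy_oneBody_anti_hopping_of_groundState_halfFilling 1 t'A hUA hωA
    hLφ (fun j => hψA _) (fun j => hψA1 _) (κ := κ) (κ' := 2 * t'A) hcA heA
  have hv := hrow ωA (id ∘ φ) ψA hLφ (fun j => hψA _) (fun j => hψA1 _) hωA hu
  rw [orbitMean_re_expect_neg_oddMomentTT_lam_zero hωA.isTranslationInvariant] at hv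
  simp only [← hκ_def] at hapx
  linarith

end Region

end Summit.Ventures.CertifiedManyBodySolver.Observables

end
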